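import Summits.ResolutionOfSingularities.ResolutionOfSingularities.Theorems.RadicialJungCleanModelsSufficeChartsSections
import Summits.ResolutionOfSingularities.ResolutionOfSingularities.Theorems.RadicialJungCleanModelsSufficeChartsOverlap

/-!
# Route `RadicialJung`, crux `CleanModelsSuffice`, line `Sketch`: the family of Kato charts on
# `V^L` and its four properties

Helper for the registered stub `stub_charts` of the skeleton of
`Summit.ResolutionOfSingularities.ResolutionOfSingularities.Theses.RadicialJung.CleanModelsSuffice`
(stmt-ResolutionOfSingularities-15883). For adapted data `D` the charts are indexed by
`{v // 0 < m v} ⊕ V`: a TOROIDAL point `v` carries the Kummer chart `φ v : P_{a' v} → Γ(V^L, ι⁻¹ U' v)`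
of `…ChartsSections`; a point `v` of REGULAR type (`m v = 0`) carries the trivial chart
`ℤ⁰ ⊇ ⊤ → Γ(V^L, ι⁻¹ U' v)` (and the index `inr v` of a toroidal `v` the empty domain). This
file proves the four clauses of the conclusion of `stub_charts` for this family: the domains
cover `V^L` (`cover`); the monoids are fs (`fs`); every chart is log regular at every point of
its domain (`isLogRegularLocal_chart`: `…ChartsSections`); and any two charts are compatible at a
common point (`chart_compatible`: a chart value which is a unit at `x` is matched by `1`;
otherwise both charts are toroidal with a charged section through `w = ι x`, and
`…ChartsOverlap.exists_associated_kci` transported along the stalk isomorphism applies).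
-/

noncomputable section

set_option linter.dupNamespace false -- mandated namespace of this single-conjunct summit

open CategoryTheory AlgebraicGeometry TopologicalSpace
open Literature.AlgebraicGeometry.Resolution

namespace Summit.ResolutionOfSingularities.ResolutionOfSingularities.Theorems.RadicialJung.CleanModelsSuffice

attribute [local instance] stalkAlgebra isScalarTower_stalkAlgebra

namespace AdaptedData

variable {p : ℕ} {V : Scheme.{0}} [IsIntegral V] {L : Type} [Field L] [Algebra V.functionField L]
variable (D : AdaptedData p V L)
variable (hNorm : ∀ {O K L : Type} [CommRing O] [IsDomain O] [Field K] [Algebra O K]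
  [IsFractionRing O K] [Field L] [Algebra K L] [Algebra O L] [IsScalarTower O K L]
  (p : ℕ) (_ : p.Prime) [CharP K p] (_ : Module.finrank K L = p) (m : ℕ)
  (t : Fin (m + 1) → O) (_ : ∀ i, t i ≠ 0) (a : Fin (m + 1) → ℕ) (_ : ∀ i, ¬ p ∣ a i)
  (y : L) (_ : y ∉ Set.range (algebraMap K L))
  (_ : y ^ p = algebraMap O L (∏ i, t i ^ a i)),
  ∃ (y' : L) (a' : Fin (m + 1) → ℕ) (c : ℕ), y' ∉ Set.range (algebraMap K L) ∧
    a' 0 = 1 ∧ (∀ i, 1 ≤ a' i ∧ a' i < p) ∧ ¬ p ∣ c ∧ (∀ i, a' i ≡ c * a i [MOD p]) ∧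
    y' ^ p = algebraMap O L (∏ i, t i ^ a' i))
variable (hp : p.Prime) [CharP V.functionField p] (hdeg : Module.finrank V.functionField L = p)

/-! ## The family -/

/-- The chart domains: `ι⁻¹ U' v` for a toroidal `v`; for the second summand, `ι⁻¹ U' v` when
`v` is of regular type and `∅` otherwise. [folklore] -/
def W : {v : V // 0 < D.m v} ⊕ V → (normalizationIn V L).Opens
  | Sum.inl v => normalizationInι V L ⁻¹ᵁ D.U' v.1
  | Sum.inr v => if D.m v = 0 then normalizationInι V L ⁻¹ᵁ D.U' v else ⊥

/-- The ranks of the chart lattices. [folklore] -/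
def n : {v : V // 0 < D.m v} ⊕ V → ℕ
  | Sum.inl v => D.m v.1 - 1 + 1
  | Sum.inr _ => 0

/-- The chart monoids: the Kummer monoid of the normalised exponents at a toroidal point, the
zero monoid otherwise. [folklore] -/
def P : ∀ i : {v : V // 0 < D.m v} ⊕ V, AddSubmonoid (Fin (D.n i) → ℤ)
  | Sum.inl v => kummerMonoid p (D.a' hNorm hp hdeg v.1 v.2)
  | Sum.inr _ => ⊤

/-- The charts: the toroidal Kummer chart by sections of `V^L`, the trivial chart otherwise.
[folklore] -/
def chart : ∀ i : {v : V // 0 < D.m v} ⊕ V,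
    Multiplicative (D.P hNorm hp hdeg i) →* Γ(normalizationIn V L, D.W i)
  | Sum.inl v => D.φ hNorm hp hdeg v.1 v.2
  | Sum.inr _ => 1

/-! ## The four properties -/

omit [CharP V.functionField p] in
/-- **The chart domains cover `V^L`.** [folklore] -/
theorem cover (x : normalizationIn V L) : ∃ i, x ∈ D.W i := by
  by_cases h : 0 < D.m (normalizationInι V L x)
  · exact ⟨Sum.inl ⟨_, h⟩, D.mem_U' _⟩
  · refine ⟨Sum.inr (normalizationInι V L x), ?_⟩
    change x ∈ (if D.m (normalizationInι V L x) = 0 then normalizationInι V L ⁻¹ᵁ D.U' _ else ⊥)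
    rw [if_pos (Nat.eq_zero_of_not_pos h)]
    exact D.mem_U' _

/-- **The chart monoids are fs** (finitely generated, saturated, spanning). [folklore] -/
theorem fs (i : {v : V // 0 < D.m v} ⊕ V) :
    (D.P hNorm hp hdeg i).FG ∧ (D.P hNorm hp hdeg i).NSMulSaturated ∧
      Submodule.span ℤ (D.P hNorm hp hdeg i : Set (Fin (D.n i) → ℤ)) = ⊤ := by
  rcases i with ⟨v, hm⟩ | v
  · exact kummerMonoid_fs p hp.pos _
  · change (⊤ : AddSubmonoid (Fin 0 → ℤ)).FG ∧ (⊤ : AddSubmonoid (Fin 0 → ℤ)).NSMulSaturated ∧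
      Submodule.span ℤ ((⊤ : AddSubmonoid (Fin 0 → ℤ)) : Set (Fin 0 → ℤ)) = ⊤
    exact ⟨AddMonoid.fg_def.mp inferInstance, fun _ _ _ => Or.inr (AddSubmonoid.mem_top _),
      Subsingleton.elim _ _⟩

omit [CharP V.functionField p] in
/-- A point of the domain of a chart of the second kind lies over a regular-type chart.
[folklore] -/
theorem of_mem_W_inr {v : V} {x : normalizationIn V L} (hx : x ∈ D.W (Sum.inr v)) :
    D.m v = 0 ∧ normalizationInι V L x ∈ D.U' v := by
  by_cases hv : D.m v = 0
  · refine ⟨hv, ?_⟩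
    have hx' : x ∈ (if D.m v = 0 then normalizationInι V L ⁻¹ᵁ D.U' v else ⊥) := hx
    rw [if_pos hv] at hx'
    exact hx'
  · have hx' : x ∈ (if D.m v = 0 then normalizationInι V L ⁻¹ᵁ D.U' v else ⊥) := hx
    rw [if_neg hv] at hx'
    exact (hx'.elim : _)

section Props

variable (hVreg : Scheme.IsRegular V)
variable (hK4 : ∀ (R : Type) [CommRing R] [IsNoetherianRing R] [IsLocalRing R] (n : ℕ)
  (P : AddSubmonoid (Fin n → ℤ)) (φ : Multiplicative P →* R),
  P.FG → P.NSMulSaturated → Submodule.span ℤ (P : Set (Fin n → ℤ)) = ⊤ →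
  LogChart.IsLogRegularLocal P φ → IsDomain R ∧ IsIntegrallyClosed R)
variable (hStruct : ∀ {A K L : Type} [CommRing A] [IsRegularLocalRing A] [Field K]
  [Algebra A K] [IsFractionRing A K] [Field L] [Algebra K L] [Algebra A L] [IsScalarTower A K L]
  (p : ℕ) (_ : p.Prime) [CharP K p] (_ : Module.finrank K L = p) (m : ℕ)
  (t : Fin (m + 1) → A) (_ : ∀ i, t i ≠ 0) (a : Fin (m + 1) → ℕ) (_ : a 0 = 1)
  (_ : ∀ i, 1 ≤ a i ∧ a i < p) (y : L) (_ : y ∉ Set.range (algebraMap K L))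
  (_ : y ^ p = algebraMap A L (∏ i, t i ^ a i)) (z : Fin p → L)
  (_ : ∀ j, z j = y ^ (j : ℕ) / algebraMap A L (∏ i, t i ^ ((j : ℕ) * a i / p))),
  Subalgebra.toSubmodule (Algebra.adjoin A (Set.range z)) = Submodule.span A (Set.range z) ∧
  LinearIndependent A z ∧ Module.Finite A (Algebra.adjoin A (Set.range z)) ∧
  IsLocalRing (Algebra.adjoin A (Set.range z)) ∧
  IsFractionRing (Algebra.adjoin A (Set.range z)) L)
variable (hLogReg : ∀ {A K L : Type} [CommRing A] [IsRegularLocalRing A] [Field K]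
  [Algebra A K] [IsFractionRing A K] [Field L] [Algebra K L] [Algebra A L] [IsScalarTower A K L]
  (p : ℕ) (_ : p.Prime) [CharP K p] (_ : Module.finrank K L = p) (m : ℕ)
  (t : Fin (m + 1) → A) (_ : ∀ i, t i ≠ 0) (a : Fin (m + 1) → ℕ) (_ : a 0 = 1)
  (_ : ∀ i, 1 ≤ a i ∧ a i < p) (y : L) (_ : y ∉ Set.range (algebraMap K L))
  (_ : y ^ p = algebraMap A L (∏ i, t i ^ a i))
  (S : Finset (Fin (m + 1))) (_ : ∀ i, i ∈ S ↔ t i ∈ IsLocalRing.maximalIdeal A)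
  (_ : S.Nonempty)
  (_ : IsRegularLocalRing (A ⧸ Ideal.span (t '' (S : Set (Fin (m + 1))))))
  (_ : ringKrullDim (A ⧸ Ideal.span (t '' (S : Set (Fin (m + 1))))) + (S.card : WithBot ℕ∞) =
    ringKrullDim A)
  (P : AddSubmonoid (Fin (m + 1) → ℤ))
  (_ : ∀ c : Fin (m + 1) → ℤ, c ∈ P ↔
    0 ≤ c 0 ∧ ∀ i : Fin (m + 1), i ≠ 0 → 0 ≤ (a i : ℤ) * c 0 + (p : ℤ) * c i)
  (φ : Multiplicative P →*
    Algebra.adjoin A (Set.range fun j : Fin p =>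
      y ^ (j : ℕ) / algebraMap A L (∏ i, t i ^ ((j : ℕ) * a i / p))))
  (_ : ∀ c : P, ((φ (Multiplicative.ofAdd c) : Algebra.adjoin A (Set.range fun j : Fin p =>
      y ^ (j : ℕ) / algebraMap A L (∏ i, t i ^ ((j : ℕ) * a i / p)))) : L) =
    y ^ ((c : Fin (m + 1) → ℤ) 0) *
      ∏ i ∈ Finset.univ.erase 0, algebraMap A L (t i) ^ ((c : Fin (m + 1) → ℤ) i)),
  LogChart.IsLogRegularLocal P φ)

include hVreg hK4 hStruct hLogReg in
/-- **Every chart is log regular at every point of its domain.** [folklore] -/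
theorem isLogRegularLocal_chart (i : {v : V // 0 < D.m v} ⊕ V) (x : normalizationIn V L)
    (hx : x ∈ D.W i) :
    LogChart.IsLogRegularLocal (D.P hNorm hp hdeg i)
      (((normalizationIn V L).presheaf.germ (D.W i) x hx).hom.toMonoidHom.comp
        (D.chart hNorm hp hdeg i)) := by
  rcases i with ⟨v, hm⟩ | v
  · exact D.isLogRegularLocal_φ hNorm hp hdeg hVreg hK4 hStruct hLogReg v hm x hx
  · obtain ⟨hv, hx'⟩ := D.of_mem_W_inr hx
    exact D.isLogRegularLocal_one hp hdeg hVreg v hv x (D.U'_le v hx') _ hx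

include hVreg hK4 hStruct hLogReg in
/-- **Any two charts are compatible at a common point**: every value of the one is a unit
multiple at `x` of some value of the other. [folklore] -/
theorem chart_compatible (i j : {v : V // 0 < D.m v} ⊕ V) (x : normalizationIn V L)
    (hi : x ∈ D.W i) (hj : x ∈ D.W j) (c : D.P hNorm hp hdeg i) : ∃ c' : D.P hNorm hp hdeg j,
      Associated ((normalizationIn V L).presheaf.germ (D.W i) x hi
          (D.chart hNorm hp hdeg i (Multiplicative.ofAdd c)))
        ((normalizationIn V L).presheaf.germ (D.W j) x hj
          (D.chart hNorm hp hdeg j (Multiplicative.ofAdd c'))) := by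
  -- the value `1` of the chart `j`
  have hone : (normalizationIn V L).presheaf.germ (D.W j) x hj
      (D.chart hNorm hp hdeg j (Multiplicative.ofAdd (0 : D.P hNorm hp hdeg j))) = 1 := by
    rw [ofAdd_zero, map_one, map_one]
  rcases i with ⟨v, hm⟩ | v
  · by_cases hunit : IsUnit ((normalizationIn V L).presheaf.germ (D.W (Sum.inl ⟨v, hm⟩)) x hi
        (D.chart hNorm hp hdeg (Sum.inl ⟨v, hm⟩) (Multiplicative.ofAdd c)))
    · exact ⟨0, by rw [hone]; exact associated_one_iff_isUnit.mpr hunit⟩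
    · -- not a unit: a charged section of `v` vanishes at `w = ι x`
      obtain ⟨e, he⟩ := D.exists_stalkIso hNorm hp hdeg hVreg hK4 hStruct hLogReg x
      have hA : ∃ i₁, D.tw v hm (normalizationInι V L x) (D.U'_le v hi) i₁ ∈
          IsLocalRing.maximalIdeal (V.presheaf.stalk (normalizationInι V L x)) := by
        by_contra hB
        push Not at hB
        have h1 := D.isUnit_kci hNorm hp hdeg v hm _ (D.U'_le v hi) hB (Multiplicative.ofAdd c)
        rw [← D.stalkIso_germ_φ hNorm hp hdeg v hm x hi e he] at h1
        exact hunit ((isUnit_map_iff e _).mp h1)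
      obtain ⟨i₁, hi₁⟩ := hA
      rcases j with ⟨v', hm'⟩ | v'
      · -- two toroidal charts: `exists_associated_kci` through the stalk isomorphism
        obtain ⟨c', hc'⟩ := D.exists_associated_kci hNorm hp hdeg hVreg v hm v' hm' _
          (D.U'_le v hi) (D.U'_le v' hj) c
        refine ⟨c', ?_⟩
        rw [← D.stalkIso_germ_φ hNorm hp hdeg v hm x hi e he,
          ← D.stalkIso_germ_φ hNorm hp hdeg v' hm' x hj e he] at hc'
        have h := hc'.map e.symm.toMonoidHom
        have h' : Associated
            ((normalizationIn V L).presheaf.germ (normalizationInι V L ⁻¹ᵁ D.U' v) x hi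
              (D.φ hNorm hp hdeg v hm (Multiplicative.ofAdd c)))
            ((normalizationIn V L).presheaf.germ (normalizationInι V L ⁻¹ᵁ D.U' v') x hj
              (D.φ hNorm hp hdeg v' hm' (Multiplicative.ofAdd c'))) := by
          simpa using h
        exact h'
      · -- `j` of the second kind: `v'` is of regular type, contradicting the charged `i₁`
        exfalso
        obtain ⟨hv', hj'⟩ := D.of_mem_W_inr hj
        obtain ⟨μ, -, hμ⟩ := D.overlap v v' _ (D.U'_le v hi) (D.U'_le v' hj')
        obtain ⟨i'', -, hiff, -⟩ := hμ (D.cidx v hm i₁) hi₁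
        have h1 : ((D.cidx v hm i₁ : Fin (D.r v)) : ℕ) < D.m v := by
          have h0 := i₁.2; rw [AdaptedData.coe_cidx]; omega
        have h2 := hiff.mp h1
        omega
  · refine ⟨0, ?_⟩
    rw [hone]
    change Associated ((normalizationIn V L).presheaf.germ (D.W (Sum.inr v)) x hi
      ((1 : Multiplicative (D.P hNorm hp hdeg (Sum.inr v)) →* _) (Multiplicative.ofAdd c))) 1
    rw [MonoidHom.one_apply, map_one]

end Props

end AdaptedData

/-- The chart domains cover `V^L` (explicit-binder form, the registered interface of this helper
file). [folklore] -/
theorem adaptedData_cover {p : ℕ} {V : Scheme.{0}} [IsIntegral V] {L : Type} [Field L]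
    [Algebra V.functionField L] (D : AdaptedData p V L) (x : normalizationIn V L) : ∃ i, x ∈ D.W i :=
  D.cover x

end Summit.ResolutionOfSingularities.ResolutionOfSingularities.Theorems.RadicialJung.CleanModelsSuffice

end
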